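import Literature.MathematicalPhysics.KineticTheory.ConfinedReach
import Literature.Probability.Process.BrownianTube
import HarnessLib

/-!
# Additive-noise SDEs with a confined drift: open sets reached by a Lipschitz control are charged (support theorem, easy half)

Trunk T-KINETIC (Literature/MathematicalPhysics/KineticTheory). For the pathwise flow `drivenFlow`
and the transition kernels `sdeKernel` of `dz = Y(z) dt + v₁ dB¹ + v₂ dB²` with a confined drift
(`ConfinedForcedFlow.lean`, `ConfinedDriftKernel.lean`), the CONTROL version of the reachability
lemma of `ConfinedReach.lean` (there: zero control, target = an attractor of the undriven flow):

* `ConfinedDrift.sdeKernel_pos_of_flow_mem` — **if the trajectory driven by the control noise path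
  `n(s) = f₁(s) v₁ + f₂(s) v₂` (with `fᵢ` Lipschitz on `[0, t]`, `fᵢ(0) = 0`) is in the open set
  `G` at time `t`, then `P_t(x, G) > 0`**: the Brownian pair stays in the `ε'`-tube around
  `(f₁, f₂)` on `[0, t]` with positive Wiener measure (`wienerPair_forall_abs_brownian_sub_le_pos`,
  `BrownianTube.lean`), and on that event the driven trajectory is `r`-close to the controlled one
  (`ConfinedDrift.exists_norm_flow_sub_flow_lt`, the flow is continuous in the noise path);
* `ConfinedDrift.sdeKernel_pos_of_forall_control` — the irreducibility form: if from every point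
  every nonempty open set is reached at some positive time by some Lipschitz control, then
  `∀ z U, IsOpen U → U.Nonempty → ∃ t > 0, P_t(z, U) > 0`.

This is the "easy inclusion" `supp P_t(x, ·) ⊇ cl{z_{x,n}(t) : n a control}` of the
Stroock–Varadhan support theorem, in the form used to prove irreducibility of degenerate
diffusions from the controllability of the associated control system (Rey-Bellet–Thomas 2002,
Prop. 4.2; Eckmann–Pillet–Rey-Bellet 1999, §3).

## References

* D. W. Stroock, S. R. S. Varadhan, *On the support of diffusion processes with applications to
  the strong maximum principle*, Proc. Sixth Berkeley Symp. III (1972) 333–359, §3–§5.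
* L. Rey-Bellet, L. E. Thomas, Comm. Math. Phys. **225** (2002) 305–329, Prop. 4.2.
* J.-P. Eckmann, C.-A. Pillet, L. Rey-Bellet, Comm. Math. Phys. **201** (1999) 657–697, §3. [folklore]
-/

noncomputable section

open MeasureTheory ProbabilityTheory Filter Topology Set Metric
open scoped NNReal ENNReal

namespace Literature.MathematicalPhysics.KineticTheory

open Literature.Probability.Process Literature.Analysis.ODE

variable {E : Type*} [NormedAddCommGroup E] [NormedSpace ℝ E] [FiniteDimensional ℝ E]
  [CompleteSpace E]

/-- The **control noise path** `n(s) = f₁(s) v₁ + f₂(s) v₂` of a pair of real controls. [folklore] -/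
def controlPath (v₁ v₂ : E) (f₁ f₂ : ℝ → ℝ) (s : ℝ) : E :=
  f₁ s • v₁ + f₂ s • v₂

omit [FiniteDimensional ℝ E] [CompleteSpace E] in
/-- The control noise path is continuous for continuous controls. [folklore] -/
theorem continuous_controlPath (v₁ v₂ : E) {f₁ f₂ : ℝ → ℝ} (hf₁ : Continuous f₁)
    (hf₂ : Continuous f₂) : Continuous (controlPath v₁ v₂ f₁ f₂) := by
  unfold controlPath; fun_prop

omit [FiniteDimensional ℝ E] [CompleteSpace E] in
/-- The control noise path lies in any submodule containing `v₁, v₂`. [folklore] -/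
theorem controlPath_mem {S : Submodule ℝ E} {v₁ v₂ : E} (h₁ : v₁ ∈ S) (h₂ : v₂ ∈ S)
    (f₁ f₂ : ℝ → ℝ) (s : ℝ) : controlPath v₁ v₂ f₁ f₂ s ∈ S :=
  S.add_mem (S.smul_mem _ h₁) (S.smul_mem _ h₂)

omit [FiniteDimensional ℝ E] [CompleteSpace E] in
/-- Norm bound for the control noise path. [folklore] -/
theorem norm_controlPath_le (v₁ v₂ : E) (f₁ f₂ : ℝ → ℝ) (s : ℝ) :
    ‖controlPath v₁ v₂ f₁ f₂ s‖ ≤ |f₁ s| * ‖v₁‖ + |f₂ s| * ‖v₂‖ := by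
  unfold controlPath
  refine (norm_add_le _ _).trans (add_le_add ?_ ?_) <;> rw [norm_smul, Real.norm_eq_abs]

omit [FiniteDimensional ℝ E] [CompleteSpace E] in
/-- The Brownian noise minus the control noise. [folklore] -/
theorem norm_pairNoise_pairPath_sub_controlPath_le (v₁ v₂ : E) (f₁ f₂ : ℝ → ℝ) (ω : WienerPair)
    (s : ℝ) :
    ‖pairNoise v₁ v₂ (pairPath ω) s - controlPath v₁ v₂ f₁ f₂ s‖ ≤
      |brownian s.toNNReal ω.1 - f₁ s| * ‖v₁‖ + |brownian s.toNNReal ω.2 - f₂ s| * ‖v₂‖ := by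
  rw [pairNoise_pairPath]
  unfold controlPath
  have h : brownian s.toNNReal ω.1 • v₁ + brownian s.toNNReal ω.2 • v₂ - (f₁ s • v₁ + f₂ s • v₂) =
      (brownian s.toNNReal ω.1 - f₁ s) • v₁ + (brownian s.toNNReal ω.2 - f₂ s) • v₂ := by
    simp only [sub_smul]; abel
  rw [h]
  refine (norm_add_le _ _).trans (add_le_add ?_ ?_) <;> rw [norm_smul, Real.norm_eq_abs]

namespace ConfinedDrift

variable {Y : E → E} (D : ConfinedDrift Y)
include D

variable [MeasurableSpace E] [BorelSpace E] [SecondCountableTopology E] {v₁ v₂ : E}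
  (hv₁ : v₁ ∈ D.noise) (hv₂ : v₂ ∈ D.noise)
include hv₁ hv₂

/-- **Support theorem, easy half (open sets reached by a Lipschitz control are charged)**: let
`f₁, f₂ : ℝ → ℝ` be continuous controls with `fᵢ(0) = 0`, `L`-Lipschitz on `[0, t]`, and suppose
the trajectory from `x` driven by the control noise path `n(s) = f₁(s) v₁ + f₂(s) v₂` is in the
open set `G` at time `t`. Then `P_t(x, G) > 0`. Indeed `B(z_{x,n}(t), r) ⊆ G` for some `r > 0`;
by continuity of the flow in the noise path (uniform norm on `[0, t]`, noise paths bounded by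
`M = (Lt + 1)(‖v₁‖ + ‖v₂‖)`), there is `δ > 0` such that every noise path `δ`-close to `n` on
`[0, t]` drives `x` into that ball; the Brownian noise `B¹ v₁ + B² v₂` is `δ`-close to `n` as soon
as `|Bⁱ_s - fᵢ(s)| ≤ ε'` on `[0, t]` (`ε' (‖v₁‖ + ‖v₂‖) ≤ δ`, `ε' ≤ 1`), an event of positive
Wiener measure by the tube estimate `wienerPair_forall_abs_brownian_sub_le_pos`.
[cite: ReyBelletThomas2002, Prop 4.2] -/
theorem sdeKernel_pos_of_flow_mem (x : E) {t : ℝ≥0} {f₁ f₂ : ℝ → ℝ} (hf₁c : Continuous f₁)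
    (hf₂c : Continuous f₂) (hf₁0 : f₁ 0 = 0) (hf₂0 : f₂ 0 = 0) {L : ℝ} (hL : 0 ≤ L)
    (hf₁ : ∀ s u : ℝ, 0 ≤ s → s ≤ u → u ≤ t → |f₁ u - f₁ s| ≤ L * (u - s))
    (hf₂ : ∀ s u : ℝ, 0 ≤ s → s ≤ u → u ≤ t → |f₂ u - f₂ s| ≤ L * (u - s))
    {G : Set E} (hG : IsOpen G) (hmem : drivenFlow Y x (controlPath v₁ v₂ f₁ f₂) t ∈ G) :
    0 < sdeKernel Y v₁ v₂ t x G := by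
  -- a ball inside `G` around the controlled endpoint
  obtain ⟨r, hr, hrG⟩ := Metric.isOpen_iff.1 hG _ hmem
  set n : ℝ → E := controlPath v₁ v₂ f₁ f₂ with hn
  have hnc : Continuous n := continuous_controlPath v₁ v₂ hf₁c hf₂c
  have hnS : ∀ s, n s ∈ D.noise := fun s => controlPath_mem hv₁ hv₂ f₁ f₂ s
  -- bounds for the controls on `[0, t]`
  have hf₁b : ∀ s ∈ Icc (0 : ℝ) t, |f₁ s| ≤ L * t := by
    intro s hs
    have h := hf₁ 0 s le_rfl hs.1 hs.2
    rw [hf₁0, sub_zero, sub_zero] at h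
    exact h.trans (mul_le_mul_of_nonneg_left hs.2 hL)
  have hf₂b : ∀ s ∈ Icc (0 : ℝ) t, |f₂ s| ≤ L * t := by
    intro s hs
    have h := hf₂ 0 s le_rfl hs.1 hs.2
    rw [hf₂0, sub_zero, sub_zero] at h
    exact h.trans (mul_le_mul_of_nonneg_left hs.2 hL)
  set C : ℝ := ‖v₁‖ + ‖v₂‖ with hC
  have hC0 : 0 ≤ C := by positivity
  set M : ℝ := (L * t + 1) * C with hM
  have hLt : 0 ≤ L * t := mul_nonneg hL t.coe_nonneg
  have hnM : ∀ s ∈ Icc (0 : ℝ) t, ‖n s‖ ≤ M := by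
    intro s hs
    refine (norm_controlPath_le v₁ v₂ f₁ f₂ s).trans ?_
    have h1 := hf₁b s hs
    have h2 := hf₂b s hs
    have hv₁0 : 0 ≤ ‖v₁‖ := norm_nonneg _
    have hv₂0 : 0 ≤ ‖v₂‖ := norm_nonneg _
    calc |f₁ s| * ‖v₁‖ + |f₂ s| * ‖v₂‖ ≤ L * t * ‖v₁‖ + L * t * ‖v₂‖ :=
          add_le_add (mul_le_mul_of_nonneg_right h1 hv₁0) (mul_le_mul_of_nonneg_right h2 hv₂0)
      _ = (L * t) * C := by rw [hC]; ring
      _ ≤ (L * t + 1) * C := mul_le_mul_of_nonneg_right (le_add_of_nonneg_right zero_le_one) hC0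
  -- continuity in the noise on `[0, t]`, noise bounded by `M`
  obtain ⟨δ, hδ, hcont⟩ := D.exists_norm_flow_sub_flow_lt (D.V x) M (t : ℝ) hr
  -- the tube of the Brownian pair
  set ε' : ℝ := min δ 1 / (C + 1) with hε'
  have hC1 : 0 < C + 1 := by positivity
  have hε'0 : 0 < ε' := div_pos (lt_min hδ one_pos) hC1
  have hε'b : C * ε' ≤ min δ 1 := by
    rw [hε', mul_div_assoc', div_le_iff₀ hC1]
    have : 0 ≤ min δ 1 := (lt_min hδ one_pos).le
    nlinarith
  have hε'1 : ε' ≤ 1 := by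
    rw [hε', div_le_one hC1]
    exact (min_le_right _ _).trans (le_add_of_nonneg_left hC0)
  set F₁ : ℝ≥0 → ℝ := fun s => f₁ s with hF₁
  set F₂ : ℝ≥0 → ℝ := fun s => f₂ s with hF₂
  set A : Set WienerPair := {ω | ∀ s : ℝ≥0, s ≤ t →
      |brownian s ω.1 - F₁ s| ≤ ε' ∧ |brownian s ω.2 - F₂ s| ≤ ε'} with hA
  have hApos : 0 < wienerPair A := by
    refine wienerPair_forall_abs_brownian_sub_le_pos t hε'0 hL (by simp [hF₁, hf₁0])
      (by simp [hF₂, hf₂0]) (fun s u hsu hut => ?_) (fun s u hsu hut => ?_)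
    · exact hf₁ s u s.coe_nonneg (by exact_mod_cast hsu) (by exact_mod_cast hut)
    · exact hf₂ s u s.coe_nonneg (by exact_mod_cast hsu) (by exact_mod_cast hut)
  -- on `A`, the solution lands in `B(z_{x,n}(t), r)`
  have hsub : A ⊆ (fun ω => sdeSolMap Y v₁ v₂ t x (pairPath ω)) ⁻¹' ball (drivenFlow Y x n t) r := by
    intro ω hωA
    rw [mem_preimage, mem_ball]
    set m : ℝ → E := pairNoise v₁ v₂ (pairPath ω) with hm
    have hmc : Continuous m := continuous_pairNoise v₁ v₂ (pairPath ω)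
    have hmS : ∀ s, m s ∈ D.noise := fun s => pairNoise_mem v₁ v₂ hv₁ hv₂ _ s
    have htube : ∀ s ∈ Icc (0 : ℝ) t,
        |brownian s.toNNReal ω.1 - f₁ s| ≤ ε' ∧ |brownian s.toNNReal ω.2 - f₂ s| ≤ ε' := by
      intro s hs
      have hst : s.toNNReal ≤ t := Real.toNNReal_le_iff_le_coe.2 hs.2
      have h := hωA _ hst
      simpa [hF₁, hF₂, Real.coe_toNNReal _ hs.1] using h
    have hclose : ∀ s ∈ Icc (0 : ℝ) t, ‖m s - n s‖ ≤ δ := by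
      intro s hs
      obtain ⟨h1, h2⟩ := htube s hs
      refine (norm_pairNoise_pairPath_sub_controlPath_le v₁ v₂ f₁ f₂ ω s).trans ?_
      have hv₁0 : 0 ≤ ‖v₁‖ := norm_nonneg _
      have hv₂0 : 0 ≤ ‖v₂‖ := norm_nonneg _
      calc |brownian s.toNNReal ω.1 - f₁ s| * ‖v₁‖ + |brownian s.toNNReal ω.2 - f₂ s| * ‖v₂‖
          ≤ ε' * ‖v₁‖ + ε' * ‖v₂‖ :=
            add_le_add (mul_le_mul_of_nonneg_right h1 hv₁0) (mul_le_mul_of_nonneg_right h2 hv₂0)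
        _ = C * ε' := by rw [hC]; ring
        _ ≤ δ := hε'b.trans (min_le_left _ _)
    have hmM : ∀ s ∈ Icc (0 : ℝ) t, ‖m s‖ ≤ M := by
      intro s hs
      obtain ⟨h1, h2⟩ := htube s hs
      have hb1 : |brownian s.toNNReal ω.1| ≤ L * t + 1 := by
        have := abs_sub_abs_le_abs_sub (brownian s.toNNReal ω.1) (f₁ s)
        linarith [hf₁b s hs, hε'1]
      have hb2 : |brownian s.toNNReal ω.2| ≤ L * t + 1 := by
        have := abs_sub_abs_le_abs_sub (brownian s.toNNReal ω.2) (f₂ s)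
        linarith [hf₂b s hs, hε'1]
      refine (norm_pairNoise_pairPath_le v₁ v₂ ω s).trans ?_
      have hv₁0 : 0 ≤ ‖v₁‖ := norm_nonneg _
      have hv₂0 : 0 ≤ ‖v₂‖ := norm_nonneg _
      calc |brownian s.toNNReal ω.1| * ‖v₁‖ + |brownian s.toNNReal ω.2| * ‖v₂‖
          ≤ (L * t + 1) * ‖v₁‖ + (L * t + 1) * ‖v₂‖ :=
            add_le_add (mul_le_mul_of_nonneg_right hb1 hv₁0) (mul_le_mul_of_nonneg_right hb2 hv₂0)
        _ = M := by rw [hM, hC]; ring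
    have h1 : ‖drivenFlow Y x m t - drivenFlow Y x n t‖ < r :=
      hcont x le_rfl m n hmc hnc hmS hnS hmM hnM hclose t ⟨t.coe_nonneg, le_rfl⟩
    have hsol : sdeSolMap Y v₁ v₂ t x (pairPath ω) = drivenFlow Y x m t := rfl
    rw [hsol, dist_eq_norm]
    exact h1
  -- conclude
  calc (0 : ℝ≥0∞) < wienerPair A := hApos
    _ ≤ wienerPair ((fun ω => sdeSolMap Y v₁ v₂ t x (pairPath ω)) ⁻¹' ball (drivenFlow Y x n t) r) :=
        measure_mono hsub
    _ = sdeKernel Y v₁ v₂ t x (ball (drivenFlow Y x n t) r) :=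
        (D.sdeKernel_apply' hv₁ hv₂ t x measurableSet_ball).symm
    _ ≤ sdeKernel Y v₁ v₂ t x G := measure_mono hrG

/-- **Irreducibility from controllability** (Rey-Bellet–Thomas 2002, Prop. 4.2, abstract form): if
from every point `z` every nonempty open set `U` is reached at some time `t > 0` by the trajectory
driven by some pair of continuous controls vanishing at `0` and Lipschitz on `[0, t]`, then
`P_t(z, U) > 0` for that `t`. [cite: ReyBelletThomas2002, Prop 4.2] -/
theorem sdeKernel_pos_of_forall_control
    (hctrl : ∀ (z : E) (U : Set E), IsOpen U → U.Nonempty →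
      ∃ t : ℝ≥0, 0 < t ∧ ∃ (f₁ f₂ : ℝ → ℝ) (L : ℝ), Continuous f₁ ∧ Continuous f₂ ∧
        f₁ 0 = 0 ∧ f₂ 0 = 0 ∧ 0 ≤ L ∧
        (∀ s u : ℝ, 0 ≤ s → s ≤ u → u ≤ t → |f₁ u - f₁ s| ≤ L * (u - s)) ∧
        (∀ s u : ℝ, 0 ≤ s → s ≤ u → u ≤ t → |f₂ u - f₂ s| ≤ L * (u - s)) ∧
        drivenFlow Y z (controlPath v₁ v₂ f₁ f₂) t ∈ U)
    (z : E) (U : Set E) (hU : IsOpen U) (hne : U.Nonempty) :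
    ∃ t : ℝ≥0, 0 < t ∧ 0 < sdeKernel Y v₁ v₂ t z U := by
  obtain ⟨t, ht, f₁, f₂, L, hf₁c, hf₂c, hf₁0, hf₂0, hL, hf₁, hf₂, hmem⟩ := hctrl z U hU hne
  exact ⟨t, ht, D.sdeKernel_pos_of_flow_mem hv₁ hv₂ z hf₁c hf₂c hf₁0 hf₂0 hL hf₁ hf₂ hU hmem⟩

end ConfinedDrift

end Literature.MathematicalPhysics.KineticTheory

end
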